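import Literature.NumberTheory.EllipticCurves.SemistabilityDefectSerreFormulaProofs
import Literature.NumberTheory.EllipticCurves.SemistabilityDefectAtThreeTameWitnessProofs
import Summits.BirchSwinnertonDyer.Rank1Residual.Additive.MinimalGoodReductionField
import Summits.BirchSwinnertonDyer.Rank1Residual.X11b.Three.CornerShapeII
import Summits.BirchSwinnertonDyer.BirchSwinnertonDyer.Theorems.AdditiveKolyvaginRoadRamifiedHabitatSignLawField
import Summits.BirchSwinnertonDyer.BirchSwinnertonDyer.Theorems.AdditiveKolyvaginRoadRamifiedHabitatSignLawStarred
import HarnessLib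

/-!
# Route `AdditiveKolyvaginRoad`, crux KS′ `LevelKolyvaginSystemsAdditive` (stmt-BirchSwinnertonDyer-21396) —
# the SEMISTABILITY-DEFECT DICTIONARY at an additive potentially good prime `p ≥ 5`: Kraus's defect
# `W.semistabilityDefectAt p` = the census index `semistabilityIndex W p` = Rohrlich's `e` = Serre's
# `12 / gcd(12, ord_p Δ_min)`; the Kodaira rows II/II* ↦ 6, IV/IV* ↦ 3; and the ramified-habitat sign law
# with the card's binder `¬ W.semistabilityDefectAt p ∣ p − 1` / `W.semistabilityDefectAt p ∣ p − 1`

Cell `pub/bsd-wall`, width seat `bsd-wall-akr-p2x-w3` g12; `--supports stmt-BirchSwinnertonDyer-21396` (helper).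
THEOREMS ONLY; no definition, no named fact, no `sorry`. BSD is not proved by any of this; KS′/KPA′ stay OPEN
at `p² ∣ N`.

The three crux cards `ramified-toric-habitat`, `division-type-slot`, `parahoric-ordinary-type-engine`
(`Cruxes/LevelKolyvaginSystemsAdditive/Ideas/`, sketch `RamifiedHabitatKuriharaSlotSketch.lean` §1, §3)
phrase the local type at the additive prime `p ≥ 5` through Kraus's defect
`WeierstrassCurve.semistabilityDefectAt W p` (`Literature/…/SemistabilityDefect.lean`): "`e ∤ p − 1`"
(supercuspidal, `e ∈ {3,4,6}`) versus "`e ∣ p − 1`" (principal series). The tree's local machinery —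
Rohrlich's `localRootNumber` case list (`Literature/…/RootNumber.lean`, `BSDRootNumber.lean`), the sign-law
files of this route (`…RamifiedHabitatSignLaw*.lean`, width seat w2) and the census of
`Summits/…/Rank1Residual/Additive/` — is phrased instead through the EXPONENT `a = ord Δ` of a minimal
model (`e := 12 / gcd(a, 12)`), because Serre's identification `|Φ_p| = 12 / gcd(12, v_p Δ)` (Invent.
Math. 15 (1972) §5.6) was in the tree only as a lower bound. It is now a theorem
(`Literature/…/SemistabilityDefectSerreFormulaProofs.lean`, this seat: p653072 / p653737), and this file is
the Summits-side dictionary: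

* §1 `semistabilityDefectAt_eq_semistabilityIndex` — for a globally minimal `W`, `p ≥ 5`, `ord_p j ≥ 0`:
  `W.semistabilityDefectAt p = semistabilityIndex W p` (the census currency of `SharpenedStatements.lean`);
  hence `semistabilityDefectAt_mem_of_addv` (`∈ {2, 3, 4, 6}` at an ADDITIVE potentially good `p`,
  from `semistabilityIndex_mem_of_addv`) and `one_lt_semistabilityDefectAt_of_addv` (the sketch's binder
  `1 < e` is automatic there); `hasGoodReductionAt_baseChange_iff_semistabilityDefectAt_dvd` (the local
  criterion of `SemistableFieldCriterion.lean` with Kraus's defect).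
* §2 Serre's table on the Kodaira rows not covered Literature-side: **`semistabilityDefectAt_eq_six_of_kodairaSymbolAt_II_or_IIstar`**,
  **`semistabilityDefectAt_eq_three_of_kodairaSymbolAt_IV_or_IVstar`** at every `p ≥ 5` (the potential
  goodness `ord_p j ≥ 0` of these rows is the tree's `valuation_j_le_one_of_kodairaSymbolAt_II_or_IIstar` /
  `…_IV_or_IVstar`, Summits-side; III/III* ↦ 4 and I₀* ↦ 2 at every odd `p` are Literature theorems of
  `SemistabilityDefectAtThreeTameWitnessProofs.lean`).
* §3 **the ramified-habitat sign law with the card's binder**: width seat w2's field forms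
  (`RamifiedHabitat.rootNumber_mul_rootNumber_twist_discr[_of_ge]_eq_one_of_not_dvd` / `…_eq_neg_one_of_dvd`,
  types II/III/IV and IV*/III*/II*) with their hypothesis `¬ 12 / gcd(a,12) ∣ p − 1` / `12 / gcd(a,12) ∣ p − 1`
  REPLACED by the sketch's `¬ W.semistabilityDefectAt p ∣ p − 1` / `W.semistabilityDefectAt p ∣ p − 1`
  (`rootNumber_mul_rootNumber_twist_discr_eq_one_of_not_semistabilityDefectAt_dvd`,
  `…_eq_neg_one_of_semistabilityDefectAt_dvd`), all six potentially good additive Kodaira types at once.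
  Still CONDITIONAL on the Modularity Theorem (`exists_isNewformOf`) and Kellock–Dokchitser's Rem. 2.2 at
  `p` (`atkinLehnerEigenvalueAt_eq_localRootNumberAt` for `E`, `E^{(p*)}`), and restricted (as w2's files
  are) to `N = M·p²` with `M` squarefree and odd `d_{K′}`.
* §4 (census currency, after §7–§9 of the Literature file): `addv_iff_not_isSemistableAt`,
  `one_lt_semistabilityDefectAt_of_addv_of_five_le` (NO potentially-good hypothesis),
  **`semistabilityDefectAt_eq_two_of_addv_of_subM`** (additive potentially multiplicative ⟹ defect `2`, so
  the sketch's `SignLawPrincipalSeries` hypothesis `e ∣ p − 1` does hold on the rows where that law is false,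
  `semistabilityDefectAt_dvd_sub_one_of_addv_of_subM`), `semistabilityDefectAt_of_addv` (the complete table).

What this does NOT do: the sign law on the potentially MULTIPLICATIVE additive rows (the sketch's
`SignLawPrincipalSeries` is misstated there, evidence #41/`RAMIFIED-HABITAT-SIGNLAW-NOTE.md`); `p ∈ {2, 3}`;
other additive primes of `E` (`M` squarefree); even `d_{K′}`. No statement of the crux is proved or
weakened here.

References: [cite: Serre1972, §5.6 (p. 312)] [cite: Rohrlich1993Compositio, Prop. 2(iv)]
[cite: KellockDokchitser2023, Rem. 2.2] [cite: SilvermanATAEC1994, IV.9 Table 4.1].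
-/

set_option autoImplicit false
set_option linter.dupNamespace false

noncomputable section

open scoped Classical NumberTheorySymbols

open IsDedekindDomain IsDedekindDomain.HeightOneSpectrum NumberField Rat.HeightOneSpectrum
  WeierstrassCurve Literature.NumberTheory.EllipticCurves Literature.NumberTheory.EllipticCurves.Rank1Residual
  Literature.NumberTheory.EllipticCurves.ModularForms Literature.NumberTheory.DiophantineGeometry
  IsDiscreteValuationRing

namespace Summit.BirchSwinnertonDyer.BirchSwinnertonDyer.Theorems.AdditiveKoly.SemistabilityDefect

/-! ## §1 Kraus's defect = the census index `semistabilityIndex` (globally minimal `W`, `p ≥ 5`, `ord_p j ≥ 0`) -/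

section Census

open Summit.BirchSwinnertonDyer.Rank1Residual Summit.BirchSwinnertonDyer.Rank1Residual.Additive

variable (W : WeierstrassCurve ℚ) [W.IsElliptic] [W.IsGloballyMinimal] (p : ℕ) [Fact p.Prime]

/-- **Kraus's defect IS the census index** (`p ≥ 5`, `ord_p j ≥ 0`, `W` globally minimal):
`W.semistabilityDefectAt p = semistabilityIndex W p = 12 / gcd(12, ord_p Δ_min(E))` — Serre 1972 §5.6 as
proved in `SemistabilityDefectSerreFormulaProofs` (`semistabilityDefectAt_eq_twelve_div_gcd_padicValInt_of_five_le`),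
read in the vocabulary of `Rank1Residual/Additive/SharpenedStatements.lean`. [cite: Serre1972, §5.6 (p. 312)] -/
theorem semistabilityDefectAt_eq_semistabilityIndex (hp5 : 5 ≤ p) (hj : 0 ≤ padicValRat p W.j) :
    W.semistabilityDefectAt p = semistabilityIndex W p :=
  W.semistabilityDefectAt_eq_twelve_div_gcd_padicValInt_of_five_le hp5 hj

/-- **At an ADDITIVE potentially good prime `p ≥ 5` the defect is `2, 3, 4` or `6`** (Serre's formula and the
census theorem `semistabilityIndex_mem_of_addv`: `ord_p Δ_min ∈ {2,3,4,6,8,9,10}` on these rows).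
[cite: Serre1972, §5.6 (p. 312)] [cite: SilvermanATAEC1994, IV.9 Table 4.1] -/
theorem semistabilityDefectAt_mem_of_addv (hp5 : 5 ≤ p) (hadd : Addv W p) (hj : 0 ≤ padicValRat p W.j) :
    W.semistabilityDefectAt p = 2 ∨ W.semistabilityDefectAt p = 3 ∨ W.semistabilityDefectAt p = 4 ∨
      W.semistabilityDefectAt p = 6 := by
  rw [semistabilityDefectAt_eq_semistabilityIndex W p hp5 hj]
  exact semistabilityIndex_mem_of_addv W p hp5 hadd hj

/-- Hence the sketch's binder **`1 < W.semistabilityDefectAt p` is AUTOMATIC** at an additive potentially good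
`p ≥ 5` (`RamifiedHabitatKuriharaSlotSketch.lean` §1). [cite: Serre1972, §5.6 (p. 312)] -/
theorem one_lt_semistabilityDefectAt_of_addv (hp5 : 5 ≤ p) (hadd : Addv W p) (hj : 0 ≤ padicValRat p W.j) :
    1 < W.semistabilityDefectAt p := by
  rcases semistabilityDefectAt_mem_of_addv W p hp5 hadd hj with h | h | h | h <;> omega

/-- **The local criterion with Kraus's defect** (census form): for `W` globally minimal, `p ≥ 5`, `ord_p j ≥ 0`,
ANY number field `F` and ANY place `w ∋ p`, `W_F` is good at `w` iff `W.semistabilityDefectAt p ∣ e(w ∣ p)` —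
`SemistableFieldCriterion.hasGoodReductionAt_baseChange_iff_semistabilityIndex_dvd` with §1.
[cite: Serre1972, §5.6 (p. 312)] [cite: SilvermanAEC2009, VII.5 Prop. 5.1] -/
theorem hasGoodReductionAt_baseChange_iff_semistabilityDefectAt_dvd (hp5 : 5 ≤ p)
    (hj : 0 ≤ padicValRat p W.j) (F : Type) [Field F] [NumberField F] (w : HeightOneSpectrum (𝓞 F))
    (hw : (p : 𝓞 F) ∈ w.asIdeal) :
    (W.baseChange F).HasGoodReductionAt w ↔
      W.semistabilityDefectAt p ∣ (Ideal.span {(p : ℤ)}).ramificationIdx' w.asIdeal := by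
  rw [semistabilityDefectAt_eq_semistabilityIndex W p hp5 hj]
  exact hasGoodReductionAt_baseChange_iff_semistabilityIndex_dvd W p F w hp5 hj hw

end Census

/-! ## §2 Serre's table on the rows II/II* and IV/IV* at `p ≥ 5` -/

section Kodaira

variable (W : WeierstrassCurve ℚ) [W.IsElliptic] {p : ℕ} (v : HeightOneSpectrum ℤ)

omit [W.IsElliptic] in
/-- The residue ring `ℤ ⧸ v` has characteristic `natGenerator v` (private plumbing, as in the Literature
tame-witness file). [folklore] -/
private theorem ringChar_int_quot_eq' : ringChar (ℤ ⧸ v.asIdeal) = natGenerator v := by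
  have hmem : (natGenerator v : ℤ) ∈ v.asIdeal := by
    rw [asIdeal_eq_span_natGenerator_int]; exact Ideal.mem_span_singleton_self _
  haveI : Nontrivial (ℤ ⧸ v.asIdeal) := Ideal.Quotient.nontrivial_iff.mpr v.isPrime.ne_top
  apply CharP.ringChar_of_prime_eq_zero (prime_natGenerator v)
  rw [← map_natCast (Ideal.Quotient.mk v.asIdeal), Ideal.Quotient.eq_zero_iff_mem]
  exact hmem

omit [W.IsElliptic] in
/-- `|j|_v ≤ 1` read as `0 ≤ ord_p j`. [folklore] -/
private theorem padicValRat_nonneg_of_valuation_le_one (hv : ((primesEquiv (R := ℤ) v : Nat.Primes) : ℕ) = p)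
    {x : ℚ} (h : v.valuation ℚ x ≤ 1) : 0 ≤ padicValRat p x := by
  by_cases hx : x = 0
  · rw [hx, padicValRat.zero]
  have hgen : natGenerator v = p := hv
  rw [valuation_eq_exp_neg_padicValRat v hx, hgen, ← WithZero.exp_zero, WithZero.exp_le_exp] at h
  omega

/-- **Kodaira II or II* at `p ≥ 5` ⟹ semistability defect `6`** (Serre 1972 §5.6: `ord_p Δ_min = 2`, resp.
`10`, `12 / gcd = 6`; in Kraus's table `e = 6 ↔` types II, II*). These rows are potentially good
(`valuation_j_le_one_of_kodairaSymbolAt_II_or_IIstar`) and `ord_p Δ_min = m_p + 1`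
(`ordMinimalDiscriminant_eq_numComponentsAt_add_one_holds`, residue characteristic `≠ 2, 3`).
[cite: Serre1972, §5.6 (p. 312)] [cite: SilvermanATAEC1994, IV.9 Table 4.1 (types II, II*: v(Δ) = 2, 10)] -/
theorem semistabilityDefectAt_eq_six_of_kodairaSymbolAt_II_or_IIstar
    (hv : ((primesEquiv (R := ℤ) v : Nat.Primes) : ℕ) = p) (hp5 : 5 ≤ p)
    (hT : W.kodairaSymbolAt v = .II ∨ W.kodairaSymbolAt v = .IIstar) :
    W.semistabilityDefectAt p = 6 := by
  haveI : PerfectField (IsLocalRing.ResidueField (v.adicCompletionIntegers ℚ)) := PerfectField.ofFinite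
  have hgen : natGenerator v = p := hv
  have h2 : ringChar (ℤ ⧸ v.asIdeal) ≠ 2 := by rw [ringChar_int_quot_eq' v, hgen]; omega
  have h3 : ringChar (ℤ ⧸ v.asIdeal) ≠ 3 := by rw [ringChar_int_quot_eq' v, hgen]; omega
  have hj : 0 ≤ padicValRat p W.j :=
    padicValRat_nonneg_of_valuation_le_one v hv (W.valuation_j_le_one_of_kodairaSymbolAt_II_or_IIstar v h2 h3 hT)
  have hadd : W.HasAdditiveReductionAt v :=
    (W.isAdditive_kodairaSymbolAt_iff_holds v).mp (isAdditive_of_eq_II_or_IIstar hT)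
  have hord : W.ordMinimalDiscriminant v = W.numComponentsAt v + 1 :=
    W.ordMinimalDiscriminant_eq_numComponentsAt_add_one_holds v hadd h2 h3
  rw [W.semistabilityDefectAt_eq_twelve_div_gcd_of_five_le v hv hp5 hj, hord]
  unfold numComponentsAt
  rcases hT with hT | hT <;> rw [hT] <;> decide

/-- **Kodaira IV or IV* at `p ≥ 5` ⟹ semistability defect `3`** (Serre 1972 §5.6: `ord_p Δ_min = 4`, resp. `8`,
`12 / gcd = 3`; Kraus: `e = 3 ↔` types IV, IV*). Potential goodness: `valuation_j_le_one_of_kodairaSymbolAt_IV_or_IVstar`.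
[cite: Serre1972, §5.6 (p. 312)] [cite: SilvermanATAEC1994, IV.9 Table 4.1 (types IV, IV*: v(Δ) = 4, 8)] -/
theorem semistabilityDefectAt_eq_three_of_kodairaSymbolAt_IV_or_IVstar
    (hv : ((primesEquiv (R := ℤ) v : Nat.Primes) : ℕ) = p) (hp5 : 5 ≤ p)
    (hT : W.kodairaSymbolAt v = .IV ∨ W.kodairaSymbolAt v = .IVstar) :
    W.semistabilityDefectAt p = 3 := by
  haveI : PerfectField (IsLocalRing.ResidueField (v.adicCompletionIntegers ℚ)) := PerfectField.ofFinite
  have hgen : natGenerator v = p := hv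
  have h2 : ringChar (ℤ ⧸ v.asIdeal) ≠ 2 := by rw [ringChar_int_quot_eq' v, hgen]; omega
  have h3 : ringChar (ℤ ⧸ v.asIdeal) ≠ 3 := by rw [ringChar_int_quot_eq' v, hgen]; omega
  have hj : 0 ≤ padicValRat p W.j :=
    padicValRat_nonneg_of_valuation_le_one v hv (W.valuation_j_le_one_of_kodairaSymbolAt_IV_or_IVstar v h2 h3 hT)
  have hadd : W.HasAdditiveReductionAt v :=
    (W.isAdditive_kodairaSymbolAt_iff_holds v).mp (isAdditive_of_eq_IV_or_IVstar hT)
  have hord : W.ordMinimalDiscriminant v = W.numComponentsAt v + 1 :=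
    W.ordMinimalDiscriminant_eq_numComponentsAt_add_one_holds v hadd h2 h3
  rw [W.semistabilityDefectAt_eq_twelve_div_gcd_of_five_le v hv hp5 hj, hord]
  unfold numComponentsAt
  rcases hT with hT | hT <;> rw [hT] <;> decide

/-- **Kodaira III or III* at `p ≥ 5` ⟹ defect `4`; I₀* ⟹ defect `2`** — pointers: these are the Literature
theorems `semistabilityDefectAt_eq_four_of_kodairaSymbolAt_eq_III_or_IIIstar` and
`semistabilityDefectAt_eq_two_of_kodairaSymbolAt_eq_Istar_zero` (valid at every odd `p`); restated here at
`p ≥ 5` only to complete Serre's table `II, III, IV, I₀*, IV*, III*, II* ↦ 6, 4, 3, 2, 3, 4, 6` in one place.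
[cite: Serre1972, §5.6 (p. 312)] [cite: SilvermanATAEC1994, IV.9 Table 4.1] -/
theorem semistabilityDefectAt_eq_four_or_two_of_kodairaSymbolAt
    (hv : ((primesEquiv (R := ℤ) v : Nat.Primes) : ℕ) = p) (hp5 : 5 ≤ p) :
    (W.kodairaSymbolAt v = .III ∨ W.kodairaSymbolAt v = .IIIstar → W.semistabilityDefectAt p = 4) ∧
      (W.kodairaSymbolAt v = .Istar 0 → W.semistabilityDefectAt p = 2) :=
  ⟨fun hK ↦ W.semistabilityDefectAt_eq_four_of_kodairaSymbolAt_eq_III_or_IIIstar v hv (by omega) hK,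
    fun hK ↦ W.semistabilityDefectAt_eq_two_of_kodairaSymbolAt_eq_Istar_zero v hv (by omega) hK⟩

end Kodaira

/-! ## §3 The ramified-habitat sign law with the card's binder on `W.semistabilityDefectAt p` -/

section SignLaw

variable {p : ℕ} [Fact p.Prime]

/-- **THE RAMIFIED-HABITAT SIGN LAW — supercuspidal half, with the sketch's binder `¬ e ∣ p − 1`,
`e := W.semistabilityDefectAt p`** (card `ramified-toric-habitat`, `RamifiedHabitatKuriharaSlotSketch.lean` §1
`SignLawSupercuspidal`, on the rows and under the restrictions of width seat w2's field forms): `E/ℚ` elliptic,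
`N_E = M·p²` (`p ≥ 5`, `M` squarefree, `p ∤ M`), additive POTENTIALLY GOOD at `p` of any Kodaira type
II/III/IV/IV*/III*/II* (`ord Δ(X) = a ∈ {2,3,4,8,9,10}` for the chosen `ℤ_p`-minimal model `X`, `ord c₄(X) > 0`,
`¬ 3 ord c₄(X) < ord Δ(X)`); `K′` imaginary quadratic with odd `d_{K′}`, `p ∣ d_{K′}`, every prime of `M` split
in `K′`. If `¬ W.semistabilityDefectAt p ∣ p − 1` then `w(E)·w(E^{(d_{K′})}) = +1`. Proof: Serre's formula in
the `p`-adic currency (`semistabilityDefectAt_eq_twelve_div_gcd_of_addVal_eq`: `e = 12 / gcd(a, 12)`) turns the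
binder into w2's `hsc`, then `RamifiedHabitat.rootNumber_mul_rootNumber_twist_discr_eq_one_of_not_dvd` (types
II/III/IV) or `…_of_ge_eq_one_of_not_dvd` (IV*/III*/II*). CONDITIONAL on the Modularity Theorem (`hmod`) and
Kellock–Dokchitser's Rem. 2.2 at `p` for `E`, `E^{(p*)}` (`hF1`, `hF1'`); BSD is not proved by this.
[cite: Serre1972, §5.6 (p. 312)] [cite: Rohrlich1993Compositio, Prop. 2(iv)] [cite: KellockDokchitser2023, Rem. 2.2] -/
theorem rootNumber_mul_rootNumber_twist_discr_eq_one_of_not_semistabilityDefectAt_dvd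
    (W : WeierstrassCurve ℚ) [W.IsElliptic]
    (hmod : exists_isNewformOf) (hF1 : W.atkinLehnerEigenvalueAt_eq_localRootNumberAt)
    (hF1' : (W.quadraticTwist (((-1 : ℤ) ^ (p / 2) * p : ℤ) : ℚ)).atkinLehnerEigenvalueAt_eq_localRootNumberAt)
    (hp5 : 5 ≤ p) {M : ℕ} (hN : W.conductorNorm ℤ = M * p ^ 2) (hM : Squarefree M) (hpM : ¬ p ∣ M) {a : ℕ}
    (hΔ : addVal ℤ_[p] (((W.baseChange ℚ_[p]).minimal ℤ_[p]).integralModel ℤ_[p]).Δ = a)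
    (ha : a = 2 ∨ a = 3 ∨ a = 4 ∨ a = 8 ∨ a = 9 ∨ a = 10)
    (hc₄ : addVal ℤ_[p] (((W.baseChange ℚ_[p]).minimal ℤ_[p]).integralModel ℤ_[p]).c₄ ≠ 0)
    (hj : ¬ 3 * addVal ℤ_[p] (((W.baseChange ℚ_[p]).minimal ℤ_[p]).integralModel ℤ_[p]).c₄ <
      addVal ℤ_[p] (((W.baseChange ℚ_[p]).minimal ℤ_[p]).integralModel ℤ_[p]).Δ)
    (K : Type) [Field K] [NumberField K] (hK : IsImaginaryQuadratic K) (hKodd : Odd (NumberField.discr K))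
    (hpd : (p : ℤ) ∣ NumberField.discr K)
    (hodd : ∀ q ∈ M.primeFactors, q ≠ 2 → J(NumberField.discr K | q) = 1)
    (htwo : 2 ∣ M → NumberField.discr K % 8 = 1)
    (hsc : ¬ W.semistabilityDefectAt p ∣ p - 1) :
    W.rootNumber * (W.quadraticTwist (NumberField.discr K : ℚ)).rootNumber = 1 := by
  rw [W.semistabilityDefectAt_eq_twelve_div_gcd_of_addVal_eq hp5 hΔ hj] at hsc
  rcases ha with h | h | h | h | h | h
  · exact RamifiedHabitat.rootNumber_mul_rootNumber_twist_discr_eq_one_of_not_dvd W hmod hF1 hF1' hp5 hN hM hpM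
      hΔ (Or.inl h) hc₄ hj K hK hKodd hpd hodd htwo hsc
  · exact RamifiedHabitat.rootNumber_mul_rootNumber_twist_discr_eq_one_of_not_dvd W hmod hF1 hF1' hp5 hN hM hpM
      hΔ (Or.inr (Or.inl h)) hc₄ hj K hK hKodd hpd hodd htwo hsc
  · exact RamifiedHabitat.rootNumber_mul_rootNumber_twist_discr_eq_one_of_not_dvd W hmod hF1 hF1' hp5 hN hM hpM
      hΔ (Or.inr (Or.inr h)) hc₄ hj K hK hKodd hpd hodd htwo hsc
  · exact RamifiedHabitat.rootNumber_mul_rootNumber_twist_discr_of_ge_eq_one_of_not_dvd W hmod hF1 hF1' hp5 hN hM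
      hpM hΔ (Or.inl h) hc₄ hj K hK hKodd hpd hodd htwo hsc
  · exact RamifiedHabitat.rootNumber_mul_rootNumber_twist_discr_of_ge_eq_one_of_not_dvd W hmod hF1 hF1' hp5 hN hM
      hpM hΔ (Or.inr (Or.inl h)) hc₄ hj K hK hKodd hpd hodd htwo hsc
  · exact RamifiedHabitat.rootNumber_mul_rootNumber_twist_discr_of_ge_eq_one_of_not_dvd W hmod hF1 hF1' hp5 hN hM
      hpM hΔ (Or.inr (Or.inr h)) hc₄ hj K hK hKodd hpd hodd htwo hsc

/-- **THE RAMIFIED-HABITAT SIGN LAW — principal-series half, with the sketch's binder `e ∣ p − 1`,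
`e := W.semistabilityDefectAt p`** (same rows and restrictions; POTENTIALLY GOOD — the hypothesis the sketch's
`SignLawPrincipalSeries` lacks on the potentially multiplicative rows): if `W.semistabilityDefectAt p ∣ p − 1`
then `w(E)·w(E^{(d_{K′})}) = −1`. CONDITIONAL on {`hmod`, F1 at `p`}; BSD is not proved by this.
[cite: Serre1972, §5.6 (p. 312)] [cite: Rohrlich1993Compositio, Prop. 2(iv)] [cite: KellockDokchitser2023, Rem. 2.2] -/
theorem rootNumber_mul_rootNumber_twist_discr_eq_neg_one_of_semistabilityDefectAt_dvd
    (W : WeierstrassCurve ℚ) [W.IsElliptic]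
    (hmod : exists_isNewformOf) (hF1 : W.atkinLehnerEigenvalueAt_eq_localRootNumberAt)
    (hF1' : (W.quadraticTwist (((-1 : ℤ) ^ (p / 2) * p : ℤ) : ℚ)).atkinLehnerEigenvalueAt_eq_localRootNumberAt)
    (hp5 : 5 ≤ p) {M : ℕ} (hN : W.conductorNorm ℤ = M * p ^ 2) (hM : Squarefree M) (hpM : ¬ p ∣ M) {a : ℕ}
    (hΔ : addVal ℤ_[p] (((W.baseChange ℚ_[p]).minimal ℤ_[p]).integralModel ℤ_[p]).Δ = a)
    (ha : a = 2 ∨ a = 3 ∨ a = 4 ∨ a = 8 ∨ a = 9 ∨ a = 10)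
    (hc₄ : addVal ℤ_[p] (((W.baseChange ℚ_[p]).minimal ℤ_[p]).integralModel ℤ_[p]).c₄ ≠ 0)
    (hj : ¬ 3 * addVal ℤ_[p] (((W.baseChange ℚ_[p]).minimal ℤ_[p]).integralModel ℤ_[p]).c₄ <
      addVal ℤ_[p] (((W.baseChange ℚ_[p]).minimal ℤ_[p]).integralModel ℤ_[p]).Δ)
    (K : Type) [Field K] [NumberField K] (hK : IsImaginaryQuadratic K) (hKodd : Odd (NumberField.discr K))
    (hpd : (p : ℤ) ∣ NumberField.discr K)
    (hodd : ∀ q ∈ M.primeFactors, q ≠ 2 → J(NumberField.discr K | q) = 1)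
    (htwo : 2 ∣ M → NumberField.discr K % 8 = 1)
    (hps : W.semistabilityDefectAt p ∣ p - 1) :
    W.rootNumber * (W.quadraticTwist (NumberField.discr K : ℚ)).rootNumber = -1 := by
  rw [W.semistabilityDefectAt_eq_twelve_div_gcd_of_addVal_eq hp5 hΔ hj] at hps
  rcases ha with h | h | h | h | h | h
  · exact RamifiedHabitat.rootNumber_mul_rootNumber_twist_discr_eq_neg_one_of_dvd W hmod hF1 hF1' hp5 hN hM hpM
      hΔ (Or.inl h) hc₄ hj K hK hKodd hpd hodd htwo hps
  · exact RamifiedHabitat.rootNumber_mul_rootNumber_twist_discr_eq_neg_one_of_dvd W hmod hF1 hF1' hp5 hN hM hpM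
      hΔ (Or.inr (Or.inl h)) hc₄ hj K hK hKodd hpd hodd htwo hps
  · exact RamifiedHabitat.rootNumber_mul_rootNumber_twist_discr_eq_neg_one_of_dvd W hmod hF1 hF1' hp5 hN hM hpM
      hΔ (Or.inr (Or.inr h)) hc₄ hj K hK hKodd hpd hodd htwo hps
  · exact RamifiedHabitat.rootNumber_mul_rootNumber_twist_discr_of_ge_eq_neg_one_of_dvd W hmod hF1 hF1' hp5 hN hM
      hpM hΔ (Or.inl h) hc₄ hj K hK hKodd hpd hodd htwo hps
  · exact RamifiedHabitat.rootNumber_mul_rootNumber_twist_discr_of_ge_eq_neg_one_of_dvd W hmod hF1 hF1' hp5 hN hM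
      hpM hΔ (Or.inr (Or.inl h)) hc₄ hj K hK hKodd hpd hodd htwo hps
  · exact RamifiedHabitat.rootNumber_mul_rootNumber_twist_discr_of_ge_eq_neg_one_of_dvd W hmod hF1 hF1' hp5 hN hM
      hpM hΔ (Or.inr (Or.inr h)) hc₄ hj K hK hKodd hpd hodd htwo hps

end SignLaw

/-! ## §4 The potentially multiplicative rows and the complete table at an additive `p ≥ 5` (census currency) -/

section PotMult

open Summit.BirchSwinnertonDyer.Rank1Residual Summit.BirchSwinnertonDyer.Rank1Residual.Additive

variable (W : WeierstrassCurve ℚ) [W.IsElliptic] (p : ℕ) [Fact p.Prime]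

/-- **`Addv W p` is "not semistable at the place of `ℤ` over `p`"** (the census predicate of
`Literature/…/Rank1Residual/Predicates.lean` read through the tree's prime/place transports,
`isSemistableAt_iff_hasGoodReductionAtPrime_or`). [cite: SilvermanAEC2009, VII.5 Prop. 5.1] -/
theorem addv_iff_not_isSemistableAt (v : HeightOneSpectrum ℤ)
    (hv : ((primesEquiv (R := ℤ) v : Nat.Primes) : ℕ) = p) :
    Addv W p ↔ ¬ W.IsSemistableAt v := by
  rw [W.isSemistableAt_iff_hasGoodReductionAtPrime_or v hv, not_or]
  rfl

/-- **The sketch's binder `1 < W.semistabilityDefectAt p` is AUTOMATIC at EVERY additive `p ≥ 5`**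
(no potentially-good or global-minimality hypothesis; supersedes `one_lt_semistabilityDefectAt_of_addv` of
§1): `one_lt_semistabilityDefectAt_of_not_isSemistableAt` of the Literature file.
[cite: Serre1972, §5.6 (p. 312)] -/
theorem one_lt_semistabilityDefectAt_of_addv_of_five_le (hp5 : 5 ≤ p) (hadd : Addv W p) :
    1 < W.semistabilityDefectAt p := by
  have hp : p.Prime := Fact.out
  set v : HeightOneSpectrum ℤ := (primesEquiv (R := ℤ)).symm ⟨p, hp⟩ with hvdef
  have hv : ((primesEquiv (R := ℤ) v : Nat.Primes) : ℕ) = p :=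
    congrArg Subtype.val ((primesEquiv (R := ℤ)).apply_symm_apply ⟨p, hp⟩)
  exact W.one_lt_semistabilityDefectAt_of_not_isSemistableAt v hv hp5
    ((addv_iff_not_isSemistableAt W p v hv).mp hadd)

/-- **ADDITIVE POTENTIALLY MULTIPLICATIVE (`Addv ∧ SubM`) at `p ≥ 5` ⟹ defect EXACTLY `2`** (Kraus; the
Literature theorem `semistabilityDefectAt_eq_two_of_not_good_of_not_mult` in the census vocabulary
`SubM W p := ord_p j < 0` of `SharpenedStatements.lean`). On these rows the sketch's `SignLawPrincipalSeries`
hypothesis `W.semistabilityDefectAt p ∣ p − 1` therefore HOLDS (`2 ∣ p − 1`) — which is why the law, as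
typed, reaches the rows where it is false (evidence #41).
[cite: Kraus1990, §1 (potentially multiplicative case), as recalled in FreitasKraus2022 §3.3] -/
theorem semistabilityDefectAt_eq_two_of_addv_of_subM (hp5 : 5 ≤ p) (hadd : Addv W p) (hM : SubM W p) :
    W.semistabilityDefectAt p = 2 :=
  W.semistabilityDefectAt_eq_two_of_not_good_of_not_mult hp5 hadd.1 hadd.2 hM

/-- Hence on the `Addv ∧ SubM` rows at `p ≥ 5` the defect DIVIDES `p − 1` (`p` odd).
[cite: Kraus1990, §1 (potentially multiplicative case), as recalled in FreitasKraus2022 §3.3] -/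
theorem semistabilityDefectAt_dvd_sub_one_of_addv_of_subM (hp5 : 5 ≤ p) (hadd : Addv W p)
    (hM : SubM W p) : W.semistabilityDefectAt p ∣ p - 1 := by
  rw [semistabilityDefectAt_eq_two_of_addv_of_subM W p hp5 hadd hM]
  have hp : p.Prime := Fact.out
  rcases hp.eq_two_or_odd with h | h <;> omega

/-- **THE COMPLETE TABLE AT AN ADDITIVE `p ≥ 5` (census currency)**: for `W` globally minimal and
`Addv W p`, the defect is `2` on the potentially multiplicative cell `SubM` and the census index
`semistabilityIndex W p ∈ {2, 3, 4, 6}` otherwise. [cite: Serre1972, §5.6 (p. 312)]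
[cite: Kraus1990, §1 (the case p ≥ 5), as recalled in FreitasKraus2022 §3.3] -/
theorem semistabilityDefectAt_of_addv [W.IsGloballyMinimal] (hp5 : 5 ≤ p) (hadd : Addv W p) :
    (SubM W p → W.semistabilityDefectAt p = 2) ∧
      (¬ SubM W p → W.semistabilityDefectAt p = semistabilityIndex W p) :=
  ⟨fun hM ↦ semistabilityDefectAt_eq_two_of_addv_of_subM W p hp5 hadd hM,
    fun hM ↦ semistabilityDefectAt_eq_semistabilityIndex W p hp5 (not_lt.mp hM)⟩

end PotMult

end Summit.BirchSwinnertonDyer.BirchSwinnertonDyer.Theorems.AdditiveKoly.SemistabilityDefect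

end
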